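import Mathlib.Data.Finset.Basic
import Mathlib.Data.Fintype.Basic
import Mathlib.Data.Sigma.Basic
import Mathlib.Order.Basic
import HarnessLib

/-!
# Hu 2025 (arXiv:2507.21400v1), §6.1 «The initial setup: ℘₀-blowups and ℓ₀-blowup» (PDF §6a) and the first half of
# §6.2.1 «℘-blowups in the block (𝔊_k)» (PDF §6b.1): the FRAME, the divisor NAMES, Def. 6.1, Ex. 6.2, Def. 6.3 —
# statements-first typing of lit/PARTITION-HU.md row 107, file `S06WpEllBlowups/R107aAssociation.lean` (1/3)
# — typed by res-type-018 (pre-draft gen 4, 2026-08-27T03:3x–04:3xZ; T9 re-read of every locator on the chunks as served +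
# filing by gen 5/gen 8 after the 08:00Z M-Hu-min OPEN; gen 8 v2 = the sampled review's three fixes, p512160). Companions: `R107bWpSets.lean` (stages,
# Def. 6.4, Def. 6.5) and `R107cWpEllBlowups.lean` (Def. 6.6–6.9, (6.2), (6.3), (6.7) Ω, the run), each importing the previous
# one (PARTITION's two names `R107aWpSets`/`R107bWpEllBlowups` ↦ three files of ≤ 40 declarations each).

**STATUS OF THE SOURCE (D-0012 / D-0089): UNREFEREED PREPRINT UNDER ADJUDICATION.** Y. Hu, *Universal
Characteristic-free Resolution of Singularities, I*, arXiv:2507.21400v1 (2025-07-29) [Hu2025]; held as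
`paper:arxiv-2507.21400` = the arXiv TeX source in 73 chunks; LOCATOR OF RECORD = chunk + line `C<cc>L<l>` (lit/PARTITION-HU.md
§0), the arXiv PDF page «p.N» next to it (renders lit/res-lit-6/hu25/hu25_pNNN.png VIEWED for pp.95–106). Statements below are
`def … : Prop` CANDIDATES tagged `[claim: Hu2025, status: under-review]` — «STATUS: candidate statement under adjudication
(D-0012/D-0089); not asserted»; definitions are REAL; nothing is proved or asserted; no declaration takes a side. AI typing,
weaker than expert review. HONEST CEILING (PARTITION-HU header): Part I claims resolution of singularity TYPES; the
summit-type claim rests on the unposted Part II.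

## What §6.1–§6.2 ARE, and the carrier level chosen (PARTITION-HU §1 «CARRIER LEVEL»)
§6.1–§6.2 (chunks p0042 l.1 – p0047 l.8; PDF pp.95–106) CONSTRUCT, by a nested induction on indices `(kτ)μh`, the sequence of
blow-ups `ℛ̃_ℓ → ⋯ → ℛ̃_{(℘_(kτ)𝔯_μ𝔰_h)} → ℛ̃_{(℘_(kτ)𝔯_μ𝔰_{h−1})} → ⋯ → ℛ̃_ϑ` together with BOOKKEEPING DATA on every scheme of the
sequence: NAMED divisors (ϖ-, ϱ-, 𝔏-divisors and exceptional divisors, proper transforms «inheriting the name»,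
C46L67–L68), and for every named divisor `Y` the MULTIPLICITIES `m_{Y,T_B}` («association», Def. 6.1/6.6/6.9) for the terms
`T_B` of the binomials `B ∈ 𝓑^gov ⊔ 𝓑^𝔯𝔟` and `m_{Y,s}` (Def. 6.3) for the terms of the linearized relations `L_F`. The ONLY
geometric input of the construction is a family of TESTS: «Z_ϕ ∩ Ṽ_{(℘_(kτ)𝔯_{μ−1})} ≠ ∅» (Def. 6.4), «Z_ϕ ∩ Ṽ_{(℘_(kτ)𝔯_μ)} = ∅
for every pre-℘-set» (Def. 6.7) and «Z_{χ_k} ∩ ℛ̃_{℘_k} ≠ ∅» (Def. 6.8) — everything else is combinatorics on names. Accordingly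
this row is typed at DATA LEVEL: divisor NAMES are a type `WpFrame.Div`, multiplicity tables are functions on names, the
orders of Def. 6.5 and the index sets (6.2)/(6.7) are relations/sets on names, and the geometric tests enter as EXPLICIT
`Prop`-valued PARAMETERS (never as `Classical.choice`; PARTITION-HU §6 (c)/(d): 𝔽 is a binder — the tests are where 𝔽 enters,
G-H4 of the prior record = INDEX ONLY). Their chart-level READINGS over an abstract chart ring `A` with named divisor ideals
(the shape of row 108's `WpEllChart` record and of row 106's Prop. 5.11 divisor ideals) are given next to them
(`meetsOnChart` in file b, `Def6_8_testChart_R1/_R2` in file c), so that rows 108/110 can instantiate. The whole construction,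
relative to the tests, is ONE datum `WpRun` with the requirement `WpRun.IsAsPrinted` (file c).

STANDING HYPOTHESIS OF §§3–8 (C15L22–L27; PDF p.32 l.3–6): «Let p be an arbitrarily fixed prime number. Let 𝔽 be either ℚ
or a finite field with p elements. From Section 3 to Section 8, every scheme considered is defined over ℤ, consequently, is
defined over 𝔽, and is considered as a scheme over the perfect field 𝔽.» Row 107 declares NO scheme and no field: the base
field enters ONLY through the geometric test parameters (`meetsV` of Def. 6.4/6.7, `meetsR` of Def. 6.8; PARTITION-HU §6 (c)),
which the instantiating rows (108/110) supply over such an `𝔽`; every decl below is uniform in that datum.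

## The frame (OURS packaging of the §§3–5 data read by §6.1–§6.2; every field ↦ the row that owns it)
Def. 6.1/6.3 read, for each block `F_k` (`k ∈ [Υ]`, C42L20 «For any k ∈ [Υ]»): the leading ϖ-index `u_k = u_{F_k}` (C42L68
«where u_k = u_{F_k}»), the ϱ-index `(m,u_k)` of the leading term, and for each non-leading term `s = s_τ ∈ S_{F_k} ∖ s_{F_k}`
(Def. 5.7/5.8, row 106: `τ ∈ [𝔱_{F_k}]`) its ϱ-index `(u_s,v_s)` and its ϖ-indices `u_s, v_s` — (eq-B-ktau) C43L83–L84 «B_(kτ) =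
T⁺_(kτ) − T⁻_(kτ) = x_{(u_s,v_s)} x_{u_k} − x_{u_s} x_{v_s} x_{(m,u_k)}». This is `structure WpFrame P Λ` with `P` = the
ϖ-indices `𝕀⋆ = 𝕀_{3,n} ∖ {m}` (row 101) and `Λ` = the GLOBAL ϱ-indices `Λ_𝔉` (row 103's term type; ϱ-divisors `X_{(u,v)}`,
`(u,v) ∈ Λ_𝔉`, C42L38–L39). DICTIONARY: row 106's chart frame `ThetaFrame P Rs` (pre-draft res-type-023, file
`S05ThetaBlowups/R106bThetaFrame`) has the SAME fields `N t ult lead termR termP₁ termP₂` with `lead/termR` valued in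
`Option Rs`, `Rs = Λ⋆` of ONE chart `𝔙_[0]` of `ℛ` (`none` = the chart's `≡ 1` coordinate): `ThetaFrame` = `WpFrame` + the
chart choice `Λ^o`. §6.1–§6.2 name divisors GLOBALLY (a ℘-set is a pair of divisors of the scheme, its centre meets some
charts and not others), hence the global `Λ` here; the owners of 106/107 may merge the two records (one-line map either way).

## Items ↦ declarations (files a = this, b, c; FQ prefix `Literature.AlgebraicGeometry.Hu2025.Statements.S06WpEllBlowups.` for the
## numbered items / claims / equations, `….S06WpEllBlowups.WpFrame.` (dot notation on the frame `W`) for the bookkeeping helpers)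
* §6.1 opening C42L7–L29; p.95 (trivial blow-ups `ℛ̃_{ℓ_0} = ℛ̃_{℘_0} = ℛ̃_{ℓ_{−1}} = ℛ̃_ϑ`; plan of the induction) ↦ module docstring.
* initial divisor sets C42L31–L55; p.95 ↦ `WpFrame.Div` (+ `Div.varpi/varrho/ell/excTheta/excWp/excEll`), `WpFrame.divsTheta`
  (𝒟_ϑ = 𝒟_{ϑ,ϱ} ⊔ 𝒟_{ϑ,ϖ} ⊔ ℰ_ϑ), `WpFrame.LDivs` (𝒟_{ϑ,𝔏}).
* Def. 6.1 C42L60–L113; p.95–96 ↦ `Def6_1` (+ `IsAssociated`, the words «Y is associated with T»); PARTITION name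
  `assocMult` ↦ `Def6_1` (initial values) / the table types `AssocB`, `AssocS`.
* Ex. 6.2 C42L115–L123; p.96 [OPT] ↦ `Ex6_2_table` (the printed TABLE of values, typed as DATA `W.Div → ℕ` AS PRINTED, note 3;
  the comparison with Def. 6.1's own `T⁻`-column is a kernel matter: `Ex6_2_table_eq_Def6_1` / `Ex6_2_table_ne_Def6_1` /
  `Ex6_2_ours` in `Proofs/S06WpEllBlowups/R107Claims.lean` — no Prop-valued candidate is made of an example).
* Def. 6.3 C42L125–L149; p.96 ↦ `Def6_3` (AS PRINTED, exceptional case with the printed free index `k` -- sic) and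
  `Def6_3_ours` (k := j).
* induction hypothesis / package C42L151–C43L72; p.96–98 ↦ file b: `WpFrame.Stage` + `Stage.LT` (the indices `(kτ)μh`,
  their order), `Div.OccLT` (order of occurrence of exceptional divisors); the sets 𝒟_{(℘_(kτ)𝔯_{μ−1}),·} are file c's
  `divsAt` / `divsBefore`; the association part of the package ↦ `IsInitialPackage` (this file).
* Def. 6.4 C43L92–L114; p.99 ↦ file b: `PreWpSet`, `IsWpSet` (= `Def6_4`), `WpFrame.wpCentreIdeal` (Z_ϕ on
  a chart), `meetsOnChart` (chart reading of «≠ ∅»); remarks C43L116–L121 ↦ `C43L118`; C43L123–L133 ↦ `C43L126`.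
* Def. 6.5 C43L137–C44L26; p.99–100 ↦ file b: `WpFrame.Def6_5_plusLT`, `Def6_5_minusLT`, `Def6_5_phiLT` (= `Def6_5`); the
  claims «By Definition 3.15, 𝒟⁺ (𝒟⁻) is totally ordered» ↦ `C44L6`, `C44L20`; the listing C44L28–L38
  «Φ = {ϕ_(kτ)μ1 < ⋯ < ϕ_(kτ)μσ}» ↦ `WpFrame.IsPhiListing` (σ_(kτ)μ = its length).
File c continues with the ℘-blow-up sequence C44L40 ff. (its module docstring lists Def. 6.6 – (6.7)).

## Reading / sic notes (none takes a side; all repeated in HOME/plan/tools/res-type-018/hu/README-hu107.md)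
1. Def. 6.1 display C42L64–L66 (p.95) prints the minus term as «x_{(m,u_k)} x_{u_s} x_{uv v_s}» [sic: `x_{v_s}`; (eq-B-ktau)
   C43L83–L84 and Def. 5.8 have `x_{u_s} x_{v_s} x_{(m,u_k)}`].
2. Def. 6.1 treats `B ∈ 𝓑^gov` ONLY; the inductive package C43L57–L62 (p.98) assumes `m_{Y,T_B}` «for any B ∈ 𝓑^𝔯𝔟 ∪ 𝓑^gov».
   No printed initial value of `m_{Y,T_B}` for `B ∈ 𝓑^𝔯𝔟` on `ℛ̃_ϑ` was found in §5–§6.1: typed as a PARAMETER of the initial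
   package (`IsInitialPackage`), not invented.
3. Ex. 6.2 (p.96) lists `X_{(123,2uv)}` — the `X_{(m,u_k)}` of this `B` — with `m_{Y,T⁻_B} = 1`, while Def. 6.1 C42L94–L98 sets
   `m_{X_{(m,u_k)},T⁻_B} = 0` («we do not associate X_{(m,u_k)} with T⁻_B»); its «0 otherwise» is also silent on Def. 6.1's
   copies to `E_{ϑ,j}`. Both typed AS PRINTED (`Def6_1`; the example as the data `Ex6_2_table` -- sic); the table read off
   Def. 6.1 (OURS reading, T5) is the column `Y ↦ Def6_1 W Y kτ 1` itself, so no separate `_ours` decl is needed — the kernel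
   comparison lives in `Proofs/S06WpEllBlowups/R107Claims.lean` (`Ex6_2_table_ne_Def6_1` at `X_{(m,u_k)}`, `Ex6_2_table_eq_Def6_1`
   on the other non-exceptional names, `Ex6_2_ours`).
4. Def. 6.3 C42L143–L145 (p.96) «Let Y = E_{ϑ,j} be any exceptional-divisor for some k ∈ [Υ]. We let m_{Y,s} =
   m_{X_{ϑ,(m,u_k)},s}»: the index `k` is not bound to `j` in print. Typed AS PRINTED with `k` an explicit extra argument
   (`Def6_3` -- sic) and the `_ours` sibling with `k := j` (`Def6_3_ours`), T5.
5. Def. 6.4 «consists of exactly two divisors» ↦ the field `plus_ne_minus` (reading recorded).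
6. Def. 6.5 C44L24 «We ϕ₁ < ϕ₂ if …» [sic: «We say»]; «By Definition (p-t)» = PDF «By Definition 3.15».
7. The test of Def. 6.4 is against `Ṽ`, the test of Def. 6.8 (file c) against `ℛ̃_{℘_k}` — recorded there (note 9).
-/

noncomputable section

namespace Literature.AlgebraicGeometry.Hu2025.Statements.S06WpEllBlowups

universe u v w

/-! ## The frame -/

/-- **The §§3–5 data read by §6.1–§6.2 (OURS packaging; dictionary in the module docstring «The frame»).** `N` = Υ
(C42L20 «For any k ∈ [Υ]»); `t k` = `𝔱_{F_k}`, the number of non-leading terms of `F_k` (C42L183 «τ ∈ [𝔱_{F_k}]»; C36L1);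
`ult k` = `u_k = u_{F_k} ∈ 𝕀^lt ⊂ 𝕀⋆` (C42L68, C43L87 «x_{u_k} is the leading variable of F̄_k for some u_k ∈ 𝕀^lt»); `lead k` =
the ϱ-index `(m,u_k)` (C42L66, C43L84); `termR k τ` = the ϱ-index `(u_{s_τ},v_{s_τ})`, `termP₁ k τ = u_{s_τ}`, `termP₂ k τ = v_{s_τ}`
of the `τ`-th non-leading term `s_τ ∈ S_{F_k} ∖ s_{F_k}` (C43L83–L88 «where s ∈ S_{F_k} ∖ s_{F_k} corresponds to τ»; Def. 5.7
order, row 106). Lean `k : Fin N` = printed `k − 1`, `τ : Fin (t k)` = printed `τ − 1` (as in row 106's `ThetaFrame`).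
[claim: Hu2025, status: under-review]
STATUS: candidate statement under adjudication (D-0012/D-0089); not asserted — OURS packaging of printed data. -/
structure WpFrame (P : Type v) (Λ : Type v) where
  /-- `Υ` -/
  N : ℕ
  /-- `𝔱_{F_k}` -/
  t : Fin N → ℕ
  /-- `u_k = u_{F_k}` -/
  ult : Fin N → P
  /-- the ϱ-index `(m,u_k)` of the leading term of `F_k` -/
  lead : Fin N → Λ
  /-- the ϱ-index `(u_{s_τ},v_{s_τ})` of the `τ`-th non-leading term of `F_k` -/
  termR : (k : Fin N) → Fin (t k) → Λ
  /-- `u_{s_τ}` -/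
  termP₁ : (k : Fin N) → Fin (t k) → P
  /-- `v_{s_τ}` -/
  termP₂ : (k : Fin N) → Fin (t k) → P

namespace WpFrame

variable {P : Type v} {Λ : Type v} [DecidableEq P] [DecidableEq Λ]
variable (W : WpFrame P Λ)

/-- **`Index_{𝓑^gov} = {(kτ) ∣ k ∈ [Υ], τ ∈ [𝔱_{F_k}]}` (C42L186–L188 «depending on (kτ) ∈ Index_{𝓑^gov} (cf. (indexing-Bmn))»;
(indexing-Bmn) = C36L23–L27, row 106 `ThetaFrame.IndexBgov` — same shape).** The index of the governing binomial `B_(kτ)`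
and of its two terms `T^±_(kτ)`.
[claim: Hu2025, status: under-review]
STATUS: candidate statement under adjudication (D-0012/D-0089); not asserted. -/
abbrev IndexBgov (W : WpFrame P Λ) : Type := Σ k : Fin W.N, Fin (W.t k)

/-- **The terms `s ∈ S_F` of the linearized relations `L_F = Σ_{s ∈ S_F} sgn(s) x_{(u_s,v_s)}` (Def. 6.3 C42L125–L129; p.96),
as indices of the multiplicities `m_{Y,s}`:** `⟨k, none⟩` = the leading term `s_{F_k}`, `⟨k, some τ⟩` = `s_τ`.
[claim: Hu2025, status: under-review]
STATUS: candidate statement under adjudication (D-0012/D-0089); not asserted — OURS indexing. -/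
abbrev STerm (W : WpFrame P Λ) : Type := Σ k : Fin W.N, Option (Fin (W.t k))

/-- The ϱ-index `(u_s, v_s)` of a term `s ∈ S_{F_k}` (C42L127, C43L67–L68 «T_s = sgn(s) x_{(u_s,v_s)}»). Plumbing.
[claim: Hu2025, status: under-review]
STATUS: candidate statement under adjudication (D-0012/D-0089); not asserted. -/
def rhoOf (s : W.STerm) : Λ := s.2.elim (W.lead s.1) (W.termR s.1)

/-! ## Divisor NAMES -/

/-- **The names of the divisors carried along §6.1–§6.2** (C42L31–L55, p.95: «the set 𝒟_{ϑ,ϖ} of the proper transforms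
X_{ϑ,w} of ϖ-divisors X_w for all w ∈ 𝕀_{3,n} ∖ m … 𝒟_{ϑ,ϱ} of the proper transforms X_{ϑ,(u,v)} of ϱ-divisors X_{(u,v)} for
all (u,v) ∈ Λ_𝔉 … ℰ_ϑ of the proper transforms E_{ϑ,k} … for all k ∈ [Υ] … 𝒟_{ϑ,𝔏} of the proper transforms D_{ϑ,L_F} … for all
F̄ ∈ 𝔉»; C44L110–L117, p.101: the new exceptional divisors `E_{(℘_(kτ)𝔯_μ𝔰_h),(kτ)μh'}`; C46L70–L72, p.104: «E_{ℓ_k} … the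
ℓ_k-exceptional divisor»). Proper transforms KEEP the name (C44L70–L96 «These are still called …»; C46L67–L68 «we take its
proper transform in ℛ̃_{ℓ_k} and let it inherit its original name»), so ONE name type serves every scheme of the sequence;
which names are present at a given stage is file c's `divsAt`. Typed as sum types (decidable equality from `P`, `Λ`).
**This type: the EXCEPTIONAL names** (Prop. 6.11 C47L83–L84 «exceptional divisor (i.e., not a ϖ- nor a ϱ-divisor nor a
𝔏-divisor)»; row 108's parameter `ιE`): summands in order = ϑ-exceptional `E_{ϑ,k}` (`k : Fin Υ`, printed `k − 1`) |
℘-exceptional `E_{·,(kτ)μh}` as `(k, τ, μ, h)` with the PRINTED naturals `τ, μ, h ≥ 1` | ℓ-exceptional `E_{ℓ_k}`.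
[claim: Hu2025, status: under-review]
STATUS: candidate statement under adjudication (D-0012/D-0089); not asserted — OURS bookkeeping of printed names. -/
abbrev Exc (W : WpFrame P Λ) : Type := Fin W.N ⊕ (Fin W.N × ℕ × ℕ × ℕ) ⊕ Fin W.N

/-- **All divisor names** (see `Exc`): `((ϖ-divisors ⊕ ϱ-divisors) ⊕ 𝔏-divisors) ⊕ exceptional divisors` — C42L50–L55
«𝒟_ϑ = 𝒟_{ϑ,ϱ} ⊔ 𝒟_{ϑ,ϖ} ⊔ ℰ_ϑ. In addition, we have 𝒟_{ϑ,𝔏}»; C45L22–L25 «𝒟_{(℘_(kτ)𝔯_μ)} := 𝒟_{…,ϖ} ⊔ 𝒟_{…,ϱ} ⊔ ℰ_{(℘_(kτ)𝔯_μ)}».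
(The grouping keeps decidable equality of names cheap to synthesize.)
[claim: Hu2025, status: under-review]
STATUS: candidate statement under adjudication (D-0012/D-0089); not asserted — OURS bookkeeping of printed names. -/
abbrev Div (W : WpFrame P Λ) : Type v := ((P ⊕ Λ) ⊕ Fin W.N) ⊕ W.Exc

namespace Div

variable {W}

/-- the ϖ-divisor `X_{·,w}`, `w ∈ 𝕀⋆` (C42L34–L36).
[claim: Hu2025, status: under-review]
STATUS: candidate statement under adjudication (D-0012/D-0089); not asserted. -/
def varpi (w : P) : W.Div := Sum.inl (Sum.inl (Sum.inl w))

/-- the ϱ-divisor `X_{·,(u,v)}`, `(u,v) ∈ Λ_𝔉` (C42L38–L40).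
[claim: Hu2025, status: under-review]
STATUS: candidate statement under adjudication (D-0012/D-0089); not asserted. -/
def varrho (r : Λ) : W.Div := Sum.inl (Sum.inl (Sum.inr r))

/-- the 𝔏-divisor `D_{·,L_{F_k}}` (C42L46–L48; «not … used until the ℓ-blowup», C42L54–L55).
[claim: Hu2025, status: under-review]
STATUS: candidate statement under adjudication (D-0012/D-0089); not asserted. -/
def ell (k : Fin W.N) : W.Div := Sum.inl (Sum.inr k)

/-- the ϑ-exceptional divisor `E_{ϑ,k}` (proper transform of `E_{ϑ[k]}`, C42L42–L44) and its later proper transforms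
(`E_{℘_k,ϑ_k}` in Def. 6.8, C46L31–L32).
[claim: Hu2025, status: under-review]
STATUS: candidate statement under adjudication (D-0012/D-0089); not asserted. -/
def excTheta (k : Fin W.N) : W.Div := Sum.inr (Sum.inl k)

/-- the ℘-exceptional divisor `E_{·,(kτ)μh}` created by the `h`-th blow-up of round `μ` for `B_(kτ)` (C44L110–L117), named by
the block `k : Fin Υ` and the PRINTED naturals `τ ∈ [𝔱_{F_k}]`, `μ, h ≥ 1`.
[claim: Hu2025, status: under-review]
STATUS: candidate statement under adjudication (D-0012/D-0089); not asserted. -/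
def excWp (k : Fin W.N) (τ μ h : ℕ) : W.Div := Sum.inr (Sum.inr (Sum.inl (k, τ, μ, h)))

/-- the ℘-exceptional divisor `E_{·,(kτ)μh}` with `(kτ)` given as an element of `Index_{𝓑^gov}` (printed `τ` = position + 1).
[claim: Hu2025, status: under-review]
STATUS: candidate statement under adjudication (D-0012/D-0089); not asserted. -/
def excWpOf (kτ : W.IndexBgov) (μ h : ℕ) : W.Div := excWp kτ.1 (kτ.2.val + 1) μ h

/-- the ℓ-exceptional divisor `E_{ℓ_k}` (C46L70–L72).
[claim: Hu2025, status: under-review]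
STATUS: candidate statement under adjudication (D-0012/D-0089); not asserted. -/
def excEll (k : Fin W.N) : W.Div := Sum.inr (Sum.inr (Sum.inr k))

/-- Case analysis on a divisor name by its kind (plumbing; no pattern matching): values on ϖ-, ϱ-, 𝔏-, ϑ-exceptional,
℘-exceptional, ℓ-exceptional names.
[claim: Hu2025, status: under-review]
STATUS: candidate statement under adjudication (D-0012/D-0089); not asserted. -/
def cases {α : Sort w} (fϖ : P → α) (fϱ : Λ → α) (fL : Fin W.N → α) (fϑ : Fin W.N → α)
    (f℘ : Fin W.N × ℕ × ℕ × ℕ → α) (fℓ : Fin W.N → α) (Y : W.Div) : α :=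
  Sum.elim (Sum.elim (Sum.elim fϖ fϱ) fL) (Sum.elim fϑ (Sum.elim f℘ fℓ)) Y

/-- «exceptional divisor (i.e., not a ϖ- nor a ϱ-divisor nor a 𝔏-divisor)» (Prop. 6.11 C47L83–L84): the name is one of
`E_{ϑ,k}`, `E_{·,(kτ)μh}`, `E_{ℓ_k}`.
[claim: Hu2025, status: under-review]
STATUS: candidate statement under adjudication (D-0012/D-0089); not asserted. -/
def IsExceptional (Y : W.Div) : Prop :=
  Div.cases (fun _ => False) (fun _ => False) (fun _ => False) (fun _ => True) (fun _ => True) (fun _ => True) Y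

/-- `Y` is a ϖ-divisor name `X_{·,w}`.
[claim: Hu2025, status: under-review]
STATUS: candidate statement under adjudication (D-0012/D-0089); not asserted. -/
def IsVarpi (Y : W.Div) : Prop :=
  Div.cases (fun _ => True) (fun _ => False) (fun _ => False) (fun _ => False) (fun _ => False) (fun _ => False) Y

end Div

/-- **`𝒟_ϑ = 𝒟_{ϑ,ϱ} ⊔ 𝒟_{ϑ,ϖ} ⊔ ℰ_ϑ`, the divisors of the initial scheme `ℛ̃_ϑ = ℛ̃_{ℓ_{−1}}` that enter the association
(C42L50–L52; p.95).** All ϖ-names, all ϱ-names, the `Υ` ϑ-exceptional names. (The 𝔏-divisors are kept apart: `LDivs`.)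
[claim: Hu2025, status: under-review]
STATUS: candidate statement under adjudication (D-0012/D-0089); not asserted. -/
def divsTheta : Set W.Div :=
  Set.range Div.varpi ∪ Set.range Div.varrho ∪ Set.range Div.excTheta

/-- **`𝒟_{ϑ,𝔏}`, the 𝔏-divisors (C42L46–L48 «for all F̄ ∈ 𝔉»; C42L54–L55 «In addition, we have 𝒟_{ϑ,𝔏}. The set 𝒟_{ϑ,𝔏}
will not be used until the ℓ-blowup»).** Note: the inductive package C43L34–L37 (p.98) lists the 𝔏-divisors of
`ℛ̃_{(℘_(kτ)𝔯_{μ−1})}` as «D_{…,L_{F_j}}, j ∈ [k−1]», whereas C44L82–L86 (p.100) carries «for all F̄ ∈ 𝔉» — recorded, the set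
plays no role in any definition before Def. 6.8, which names `D_{℘_k,L_{F_k}}` directly.
[claim: Hu2025, status: under-review]
STATUS: candidate statement under adjudication (D-0012/D-0089); not asserted. -/
def LDivs : Set W.Div := Set.range Div.ell

/-! ## «Association»: multiplicity tables (Def. 6.1, Def. 6.3; updated by Def. 6.6 / 6.9 in file c) -/

/-- **The multiplicities `m_{Y,T_B}` as a table** (C42L110–L111 «We call the number m_{Y,T^±_B} the multiplicity of Y
associated with the term T^±_B»; C43L59–L62 «Fix any Y ∈ 𝒟 … Consider any B ∈ 𝓑^𝔯𝔟 ∪ 𝓑^gov and let T_B be any fixed term of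
B. Then … Y is associated with T_B with the multiplicity m_{Y,T_B}, a nonnegative integer»): a function of the divisor NAME,
the binomial (an index type `Bin` for `𝓑^gov ⊔ 𝓑^𝔯𝔟`; row 104/105 own `𝓑^𝔯𝔟`, the governing ones are embedded by a map
`Index_{𝓑^gov} → Bin`) and the term `T^i_B`, `i = 0, 1` (Def. 6.6 C45L68 «we write B = T⁰_B − T¹_B»; for `B_(kτ)`:
`T⁰ = T⁺`, `T¹ = T⁻`, C43L83 «B_(kτ) = T⁺_(kτ) − T⁻_(kτ)»). PARTITION name `assocMult`.
[claim: Hu2025, status: under-review]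
STATUS: candidate statement under adjudication (D-0012/D-0089); not asserted — OURS bookkeeping. -/
abbrev AssocB (W : WpFrame P Λ) (Bin : Type w) : Type (max v w) := W.Div → Bin → Fin 2 → ℕ

/-- **The multiplicities `m_{Y,s}` as a table** (C42L147 «the multiplicity of Y associated with s ∈ S_F»; C43L67–L69).
[claim: Hu2025, status: under-review]
STATUS: candidate statement under adjudication (D-0012/D-0089); not asserted — OURS bookkeeping. -/
abbrev AssocS (W : WpFrame P Λ) : Type v := W.Div → W.STerm → ℕ

/-- **«Y is associated with T» ⟺ its multiplicity is positive** (C42L111–L113 «We say Y is associated with T^±_B if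
m_{Y,T^±_B} is positive. We do not say Y is associated with T^±_B if the multiplicity m_{Y,T^±_B} is zero»; likewise
C42L148–L149, C43L64–L72, C45L85–L88, C46L101–L102).
[claim: Hu2025, status: under-review]
STATUS: candidate statement under adjudication (D-0012/D-0089); not asserted. -/
def IsAssociated (m : ℕ) : Prop := 0 < m

/-- **Definition 6.1 (C42L60–L113; p.95–96) — the initial multiplicities `m_{Y,T^±_B}` on `ℛ̃_ϑ` for a GOVERNING binomial
`B = B_(kτ) = T⁺_B − T⁻_B : x_{(u_s,v_s)} x_{u_k} − x_{(m,u_k)} x_{u_s} x_{v_s}` [sic: printed «x_{uv v_s}», note 1], `k ∈ [Υ]`,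
`s ∈ S_{F_k}`, `u_k = u_{F_k}`.** «Let Y = X_{ϑ,u} be any ϖ divisor for some u ∈ 𝕀_{3,n}. We set m_{Y,T⁺_B} = 1 if u = u_k,
0 otherwise; m_{Y,T⁻_B} = 1 if u = u_s or u = v_s, 0 otherwise. Let Y = X_{ϑ,(u,v)} be any ϱ divisor. We set m_{Y,T⁺_B} = 1 if
(u,v) = (u_s,v_s), 0 otherwise. Due to Corollary (no-(m,u)) [= Cor. 5.18], we do not associate X_{(m,u_k)} with T⁻_B. Hence,
we set m_{Y,T⁻_B} = 0. Let Y = E_{ϑ,j} be any exceptional-divisor for some j ∈ [Υ]. If k = j, we set m_{Y,T⁺_B} = m_{Y,T⁻_B} =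
0. Suppose now k ≠ j. We set m_{Y,T⁺_B} = 0, m_{Y,T⁻_B} = m_{X_{ϑ,u_j},T⁻_B}.» Typed on names: `i = 0` is `T⁺`, `i = 1` is `T⁻`;
the 𝔏-divisors and the (not yet existing) ℘- or ℓ-exceptional names get the junk value `0` (Def. 6.1 speaks of «any ϖ-divisor,
ϱ-divisor, or exceptional divisor Y on ℛ̃_ϑ» only). Only `B ∈ 𝓑^gov` is covered by the print (note 2).
[claim: Hu2025, status: under-review]
STATUS: candidate statement under adjudication (D-0012/D-0089); not asserted. -/
def _root_.Literature.AlgebraicGeometry.Hu2025.Statements.S06WpEllBlowups.Def6_1 (W : WpFrame P Λ) (Y : W.Div) (kτ : W.IndexBgov) (i : Fin 2) : ℕ :=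
  Div.cases
    (fun u => if i = 0 then (if u = W.ult kτ.1 then 1 else 0)
      else (if u = W.termP₁ kτ.1 kτ.2 ∨ u = W.termP₂ kτ.1 kτ.2 then 1 else 0))
    (fun r => if i = 0 then (if r = W.termR kτ.1 kτ.2 then 1 else 0) else 0)
    (fun _ => 0)
    (fun j => if kτ.1 = j then 0
      else (if i = 0 then 0
        else (if W.ult j = W.termP₁ kτ.1 kτ.2 ∨ W.ult j = W.termP₂ kτ.1 kτ.2 then 1 else 0)))
    (fun _ => 0) (fun _ => 0) Y

/-- **`assocMult` — lit/PARTITION-HU.md row 107's expected name for Def. 6.1's multiplicities** («the instrumental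
notion: "association" with multiplicity», C42L57–L58; «We call the number m_{Y,T^±_B} the multiplicity of Y associated with
the term T^±_B», C42L110; p.95–96): the initial multiplicity `m_{Y,T^i_{B_(kτ)}}` on `ℛ̃_ϑ` — alias of `Def6_1` (name
concordance only; the running tables are `AssocB`/`AssocS`, updated by Def. 6.6/6.9 in file c).
[claim: Hu2025, status: under-review]
STATUS: candidate statement under adjudication (D-0012/D-0089); not asserted. -/
abbrev _root_.Literature.AlgebraicGeometry.Hu2025.Statements.S06WpEllBlowups.assocMult (W : WpFrame P Λ) (Y : W.Div) (kτ : W.IndexBgov) (i : Fin 2) : ℕ :=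
  Def6_1 W Y kτ i

/-- **Example 6.2 (C42L115–L123; p.96) [OPT] — the printed TABLE of values, typed as DATA, AS PRINTED.** «Let B = T⁺_B − T⁻_B =
x_{2uv} x_{(12u,23v)} − x_{12u} x_{23v} x_{(123,2uv)}. Then, we have m_{Y,T⁻_B} = 1 if Y = X_{12u}, X_{23v} or X_{(123,2uv)};
0 otherwise.» For the block with `u_k = (2uv)`, `(u_s,v_s) = (12u,23v)`, `(m,u_k) = (123,2uv)`: the function on divisor NAMES with
value `1` on `X_{u_s}`, `X_{v_s}`, `X_{(m,u_k)}` and `0` on every other name. -- sic (reading note 3): Def. 6.1 C42L94–L98 sets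
`m_{X_{(m,u_k)},T⁻_B} = 0` («we do not associate X_{(m,u_k)} with T⁻_B») and copies `m_{X_{u_j},T⁻_B}` to `E_{ϑ,j}` (`j ≠ k`), so
this table and Def. 6.1's `T⁻`-column `Y ↦ Def6_1 W Y kτ 1` differ AS PRINTED (at `X_{(m,u_k)}`, and possibly at the ϑ-exceptional
names); an example is not a claim, so it is NOT typed as a `Prop` candidate: the disagreement / agreement with Def. 6.1 is
recorded as kernel theorems `Ex6_2_table_ne_Def6_1`, `Ex6_2_table_eq_Def6_1`, `Ex6_2_ours` in
`Proofs/S06WpEllBlowups/R107Claims.lean`; no side taken on which printed item carries the slip.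
[claim: Hu2025, status: under-review]
STATUS: candidate statement under adjudication (D-0012/D-0089); not asserted — a printed example's table, as data. -/
def _root_.Literature.AlgebraicGeometry.Hu2025.Statements.S06WpEllBlowups.Ex6_2_table (W : WpFrame P Λ) (kτ : W.IndexBgov) (Y : W.Div) : ℕ :=
  Div.cases
    (fun u => if u = W.termP₁ kτ.1 kτ.2 ∨ u = W.termP₂ kτ.1 kτ.2 then 1 else 0)
    (fun r => if r = W.lead kτ.1 then 1 else 0)
    (fun _ => 0) (fun _ => 0) (fun _ => 0) (fun _ => 0) Y

/-- **Definition 6.3 (C42L125–L149; p.96), AS PRINTED — the initial multiplicities `m_{Y,s}` on `ℛ̃_ϑ` for the terms of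
`L_F = Σ_{s ∈ S_F} sgn(s) x_{(u_s,v_s)}`.** «Fix any s ∈ S_F. Consider any ϖ-divisor, ϱ-divisor, or exceptional-divisor Y on
ℛ̃_ϑ. Let Y = X_{ϑ,w} be any ϖ divisor for some w ∈ 𝕀_{3,n}. We set m_{Y,s} = 0. Let Y = X_{ϑ,(u,v)} be any ϱ divisor. We set
m_{Y,s} = 1 if (u,v) = (u_s,v_s), 0 otherwise. Let Y = E_{ϑ,j} be any exceptional-divisor for some k ∈ [Υ] [sic: the printed
index `k` is not bound to `j` — note 4]. We let m_{Y,s} = m_{X_{ϑ,(m,u_k)},s}.» Typed literally with the printed `k` as an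
EXPLICIT extra argument `kAux` (used only in the exceptional case); the evident reading `k := j` is `Def6_3_ours`.
[claim: Hu2025, status: under-review]
STATUS: candidate statement under adjudication (D-0012/D-0089); not asserted. -/
def _root_.Literature.AlgebraicGeometry.Hu2025.Statements.S06WpEllBlowups.Def6_3 (W : WpFrame P Λ) (kAux : Fin W.N) (Y : W.Div) (s : W.STerm) : ℕ :=
  Div.cases (fun _ => 0) (fun r => if r = W.rhoOf s then 1 else 0) (fun _ => 0)
    (fun _ => if W.lead kAux = W.rhoOf s then 1 else 0) (fun _ => 0) (fun _ => 0) Y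

/-- **Definition 6.3, OURS sibling (T5) with the exceptional case read `m_{E_{ϑ,j},s} = m_{X_{ϑ,(m,u_j)},s}`** (note 4):
`1` iff `(u_s,v_s) = (m,u_j)`, i.e. `s` is the leading term of `F_j`.
[claim: Hu2025, status: under-review]
STATUS: candidate statement under adjudication (D-0012/D-0089); not asserted — OURS reading of a printed index. -/
def _root_.Literature.AlgebraicGeometry.Hu2025.Statements.S06WpEllBlowups.Def6_3_ours (W : WpFrame P Λ) (Y : W.Div) (s : W.STerm) : ℕ :=
  Div.cases (fun _ => 0) (fun r => if r = W.rhoOf s then 1 else 0) (fun _ => 0)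
    (fun j => if W.lead j = W.rhoOf s then 1 else 0) (fun _ => 0) (fun _ => 0) Y

/-- **The initial «association» package on `ℛ̃_ϑ = ℛ̃_{(℘_(11)𝔯_0)}`** (C43L1–L4 «the initial scheme is ℛ_{(℘_(k1)𝔯_0)} :=
ℛ̃_{ℓ_{k−1}}. When k = 0 [sic], we get … ℛ̃_ϑ»; package C43L20–L72): tables `m`, `mS` whose governing columns are Def. 6.1's
(via the embedding `gov : Index_{𝓑^gov} → Bin`) and whose `S`-table is Def. 6.3's (OURS reading `k := j`; replace by
`Def6_3 W kAux` for the literal one). The `𝓑^𝔯𝔟`-columns are NOT determined by the print (note 2) — they are whatever the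
instantiation supplies.
[claim: Hu2025, status: under-review]
STATUS: candidate statement under adjudication (D-0012/D-0089); not asserted. -/
def IsInitialPackage {Bin : Type w} (gov : W.IndexBgov → Bin) (m : W.AssocB Bin) (mS : W.AssocS) : Prop :=
  (∀ Y kτ i, m Y (gov kτ) i = Def6_1 W Y kτ i) ∧ (∀ Y s, mS Y s = Def6_3_ours W Y s)

end WpFrame

end Literature.AlgebraicGeometry.Hu2025.Statements.S06WpEllBlowups

end
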